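import Summits.Ventures.LatticeQCDFlow.Exactness.Phi4IndependenceSamplerExact
import HarnessLib

/-!
# The flow (independence Metropolis) sampler of lattice φ⁴ is reversible: detailed balance, integrated form

HONEST FRAMING: exact (Metropolis-corrected) sampling algorithms for lattice gauge theory;
figures of merit are autocorrelation/cost numbers at stated couplings and volumes; no
continuum-physics claim.  (SCALAR calibration rung S0-A: not a gauge result.)

Venture `LatticeQCDFlow` (cell pub-lqcd), topic `Exactness`; FANOUT row 2 (`s0-phi4`: the FLOW arm
of the 2D φ⁴ calibration — real-NVP proposals with the independence-Metropolis test; battery leg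
T2a "pointwise detailed balance").  NEW WORK of the cell (one Fubini swap on `X × X`); nothing is
cited as a fact.  Printed counterparts, named only: Hastings 1970, Tierney 1994/1998 (independence
Metropolis–Hastings is reversible), Albergo–Kanwar–Shanahan 2019 §II.C.

Relation to the tree.  `Exactness/Phi4IndependenceSamplerExact.lean` (row 2) proved EXACTNESS
(`imh_integral_invariant`, `imh_exact_phi4`: `∫ (K f) e^{−S} = ∫ f e^{−S}`) and, pointwise,
detailed balance in density form (`imh_accept_mul_weight`: `α(t,t') q(t') w(t) = s(t,t')`, `s`
symmetric).  `Exactness/IMHKernel.lean` (row 30) has reversibility abstractly as a Mathlib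
`Kernel.IsReversible`.  This file integrates the pointwise identity: the sampler's one-step
operator is SELF-ADJOINT on `L²(w dμ)` — detailed balance of the chain in the integrated form used
by row 2's files, for bounded observables; exactness is its case `h = 1`.

## What is proved

* §1 (general measure space `(X, μ)`, `μ` s-finite; positive measurable integrable weight `w`
  and proposal density `q` — `∫ q = 1` is NOT needed for the symmetry).  `imh_line` — the
  pointwise expansion `(K g)(t)·c·w(t) = ∫ s(t,·) g c + g(t) c w(t) ∫q − ∫ s(t,·) g(t) c`;
  **`imh_integral_symm`** — for bounded measurable `g`, `h`:
  `∫ (K g)·h·w dμ = ∫ g·(K h)·w dμ`,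
  `(K g)(t) = ∫ [α g(t') + (1 − α) g(t)] q(t') dμ(t')`, `α = min(1, (w t' q t)/(w t q t'))`
  (Fubini on the symmetric flow `s(t,t') = min(w t q t', w t' q t)`; the rejected mass is diagonal).
* §2 (the lattice `Fin (n+1) → ℝ`).  **`imh_reversible`** — coercive action, positive measurable
  integrable model density `q`, bounded measurable `f`, `g`:
  `∫ (K f)·g·e^{−S} dφ = ∫ f·(K g)·e^{−S} dφ` for row 2's `imhOpPhi4`; **`imh_reversible_phi4`** —
  EVERY `λ > 0`, EVERY real `J`, EVERY positive model density: `⟨(K f) g⟩ = ⟨f (K g)⟩` in the φ⁴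
  Gibbs law — the flow sampler with accept/reject satisfies detailed balance however badly the
  flow is trained.

With `Exactness/Phi4HMCReversible.lean` (HMC) this types detailed balance for two of the three
S0-A sampler families in integrated form; the local Metropolis hit has it pointwise on each
coordinate line (`Phi4LocalMetropolisExact.accept_mul_weight`, `metroFlow_symm`).  NOT CLAIMED:
spectral gaps, geometric ergodicity (needs `sup w/q < ∞`), unbounded observables.
-/

namespace Summit.Ventures.LatticeQCDFlow.Exactness

open Real MeasureTheory Finset Filter
open Summit.Ventures.LatticeQCDFlow.Scoring

/-! ## §1 Independence Metropolis–Hastings is self-adjoint on `L²(w dμ)` -/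

section General

variable {X : Type*} [MeasurableSpace X] {μ : Measure X} [SFinite μ]

omit [SFinite μ] in
/-- **Pointwise expansion of the paired integrand.**  For every `t` and every constant `c`
(the value `h t` of the test observable):
`(∫ [α g(t') + (1 − α) g(t)] q(t') dt') · c · w(t)
   = ∫ s(t,t') g(t') c dt' + g(t) c w(t) ∫ q − ∫ s(t,t') g(t) c dt'`. -/
theorem imh_line {w q g : X → ℝ} (hw0 : ∀ t, 0 < w t) (hwm : Measurable w) (hq0 : ∀ t, 0 < q t)
    (hqm : Measurable q) (hqi : Integrable q μ) (hgm : Measurable g) {B : ℝ} (hgb : ∀ t, |g t| ≤ B)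
    (t : X) (c : ℝ) :
    (∫ t', (min 1 (w t' * q t / (w t * q t')) * g t'
        + (1 - min 1 (w t' * q t / (w t * q t'))) * g t) * q t' ∂μ) * c * w t
      = (∫ t', imhFlow w q t t' * g t' * c ∂μ) + g t * c * w t * (∫ t', q t' ∂μ)
        - ∫ t', imhFlow w q t t' * g t * c ∂μ := by
  have ha_le : ∀ t', min (1 : ℝ) (w t' * q t / (w t * q t')) ≤ 1 := fun t' => min_le_left _ _
  have ha_nn : ∀ t', 0 ≤ min (1 : ℝ) (w t' * q t / (w t * q t')) := fun t' =>
    le_min zero_le_one (div_nonneg (mul_pos (hw0 t') (hq0 t)).le (mul_pos (hw0 t) (hq0 t')).le)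
  have ham : Measurable fun t' => min (1 : ℝ) (w t' * q t / (w t * q t')) :=
    measurable_const.min ((hwm.mul_const (q t)).div (hqm.const_mul (w t)))
  have hI1 : Integrable (fun t' => min 1 (w t' * q t / (w t * q t')) * g t' * q t') μ := by
    refine Integrable.mono' (hqi.const_mul B) ((ham.mul hgm).mul hqm).aestronglyMeasurable
      (Eventually.of_forall fun t' => ?_)
    rw [Real.norm_eq_abs, abs_mul, abs_mul, abs_of_nonneg (ha_nn t'), abs_of_nonneg (hq0 _).le]
    calc min 1 (w t' * q t / (w t * q t')) * |g t'| * q t' ≤ 1 * B * q t' := by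
          gcongr
          · exact (hq0 _).le
          · exact ha_le t'
          · exact hgb t'
      _ = B * q t' := by ring
  have hI3 : Integrable (fun t' => min 1 (w t' * q t / (w t * q t')) * g t * q t') μ := by
    refine Integrable.mono' (hqi.const_mul B) ((ham.mul measurable_const).mul hqm).aestronglyMeasurable
      (Eventually.of_forall fun t' => ?_)
    rw [Real.norm_eq_abs, abs_mul, abs_mul, abs_of_nonneg (ha_nn t'), abs_of_nonneg (hq0 _).le]
    calc min 1 (w t' * q t / (w t * q t')) * |g t| * q t' ≤ 1 * B * q t' := by
          gcongr
          · exact (hq0 _).le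
          · exact ha_le t'
          · exact hgb t
      _ = B * q t' := by ring
  have hI2 : Integrable (fun t' => (1 - min 1 (w t' * q t / (w t * q t'))) * g t * q t') μ := by
    have e : (fun t' => (1 - min 1 (w t' * q t / (w t * q t'))) * g t * q t')
        = fun t' => g t * q t' - min 1 (w t' * q t / (w t * q t')) * g t * q t' := by
      funext t'; ring
    rw [e]
    exact (hqi.const_mul (g t)).sub hI3
  have hsplit : ∀ t', (min 1 (w t' * q t / (w t * q t')) * g t'
      + (1 - min 1 (w t' * q t / (w t * q t'))) * g t) * q t'
      = min 1 (w t' * q t / (w t * q t')) * g t' * q t'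
        + (1 - min 1 (w t' * q t / (w t * q t'))) * g t * q t' := fun t' => by ring
  simp only [hsplit]
  rw [integral_add hI1 hI2]
  have hsplit2 : ∀ t', (1 - min 1 (w t' * q t / (w t * q t'))) * g t * q t'
      = g t * q t' - min 1 (w t' * q t / (w t * q t')) * g t * q t' := fun t' => by ring
  simp only [hsplit2]
  rw [integral_sub (hqi.const_mul (g t)) hI3, integral_const_mul]
  have e1 : (∫ t', min 1 (w t' * q t / (w t * q t')) * g t' * q t' ∂μ) * c * w t
      = ∫ t', imhFlow w q t t' * g t' * c ∂μ := by
    rw [mul_assoc, ← integral_mul_const]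
    refine integral_congr_ae (Eventually.of_forall fun t' => ?_)
    dsimp only
    rw [← imh_accept_mul_weight w q (hw0 t) (hq0 t')]
    ring
  have e3 : (∫ t', min 1 (w t' * q t / (w t * q t')) * g t * q t' ∂μ) * c * w t
      = ∫ t', imhFlow w q t t' * g t * c ∂μ := by
    rw [mul_assoc, ← integral_mul_const]
    refine integral_congr_ae (Eventually.of_forall fun t' => ?_)
    dsimp only
    rw [← imh_accept_mul_weight w q (hw0 t) (hq0 t')]
    ring
  rw [← e1, ← e3]
  ring

/-- **INDEPENDENCE METROPOLIS–HASTINGS IS SELF-ADJOINT ON `L²(w dμ)`.**  For a positive integrable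
weight `w`, a positive integrable proposal density `q`, and bounded measurable `g`, `h`:
`∫ (K g)·h·w dμ = ∫ g·(K h)·w dμ`, where
`(K g)(t) = ∫ [α g(t') + (1 − α) g(t)] q(t') dμ(t')`, `α = min(1, (w t' q t)/(w t q t'))` —
detailed balance in integrated form (exactness, `imh_integral_invariant`, is the case `h = 1`). -/
theorem imh_integral_symm {w q g h : X → ℝ} (hw0 : ∀ t, 0 < w t) (hwm : Measurable w)
    (hwi : Integrable w μ) (hq0 : ∀ t, 0 < q t) (hqm : Measurable q) (hqi : Integrable q μ)
    (hgm : Measurable g) (hhm : Measurable h) {Bg Bh : ℝ} (hgb : ∀ t, |g t| ≤ Bg)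
    (hhb : ∀ t, |h t| ≤ Bh) :
    ∫ t, (∫ t', (min 1 (w t' * q t / (w t * q t')) * g t'
        + (1 - min 1 (w t' * q t / (w t * q t'))) * g t) * q t' ∂μ) * h t * w t ∂μ
      = ∫ t, g t * (∫ t', (min 1 (w t' * q t / (w t * q t')) * h t'
        + (1 - min 1 (w t' * q t / (w t * q t'))) * h t) * q t' ∂μ) * w t ∂μ := by
  -- the dominating function `w t · q t'` on the product
  have hGm : Measurable fun p : X × X => w p.1 * q p.2 :=
    (hwm.comp measurable_fst).mul (hqm.comp measurable_snd)
  have hG : Integrable (fun p : X × X => w p.1 * q p.2) (μ.prod μ) := hwi.mul_prod hqi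
  have hsm : Measurable fun p : X × X => imhFlow w q p.1 p.2 := by
    unfold imhFlow
    exact ((hwm.comp measurable_fst).mul (hqm.comp measurable_snd)).min
      ((hwm.comp measurable_snd).mul (hqm.comp measurable_fst))
  have hs_le : ∀ t t', |imhFlow w q t t'| ≤ w t * q t' := by
    intro t t'
    unfold imhFlow
    rw [abs_of_nonneg (le_min (mul_nonneg (hw0 t).le (hq0 t').le)
      (mul_nonneg (hw0 t').le (hq0 t).le))]
    exact min_le_left _ _
  -- generic integrability of `s(t,t') · a(t') · b(t)` for bounded measurable `a`, `b`
  have hprod : ∀ {a b : X → ℝ}, Measurable a → Measurable b → ∀ {Ba Bb : ℝ},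
      (∀ t, |a t| ≤ Ba) → (∀ t, |b t| ≤ Bb) →
      Integrable (fun p : X × X => imhFlow w q p.1 p.2 * a p.2 * b p.1) (μ.prod μ) := by
    intro a b ham hbm Ba Bb hab hbb
    refine Integrable.mono' (hG.const_mul (Ba * Bb))
      ((hsm.mul (ham.comp measurable_snd)).mul (hbm.comp measurable_fst)).aestronglyMeasurable
      (Eventually.of_forall fun p => ?_)
    have hBa : 0 ≤ Ba := (abs_nonneg _).trans (hab p.2)
    rw [Real.norm_eq_abs, abs_mul, abs_mul]
    calc |imhFlow w q p.1 p.2| * |a p.2| * |b p.1| ≤ (w p.1 * q p.2) * Ba * Bb := by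
          have h1 : |imhFlow w q p.1 p.2| * |a p.2| ≤ (w p.1 * q p.2) * Ba :=
            mul_le_mul (hs_le _ _) (hab _) (abs_nonneg _) (mul_nonneg (hw0 _).le (hq0 _).le)
          exact mul_le_mul h1 (hbb _) (abs_nonneg _)
            (mul_nonneg (mul_nonneg (hw0 _).le (hq0 _).le) hBa)
      _ = Ba * Bb * (w p.1 * q p.2) := by ring
  -- the two sides, expanded pointwise
  have hL : ∀ t, (∫ t', (min 1 (w t' * q t / (w t * q t')) * g t'
      + (1 - min 1 (w t' * q t / (w t * q t'))) * g t) * q t' ∂μ) * h t * w t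
      = (∫ t', imhFlow w q t t' * g t' * h t ∂μ) + g t * h t * w t * (∫ t', q t' ∂μ)
        - ∫ t', imhFlow w q t t' * g t * h t ∂μ :=
    fun t => imh_line hw0 hwm hq0 hqm hqi hgm hgb t (h t)
  have hR : ∀ t, g t * (∫ t', (min 1 (w t' * q t / (w t * q t')) * h t'
      + (1 - min 1 (w t' * q t / (w t * q t'))) * h t) * q t' ∂μ) * w t
      = (∫ t', imhFlow w q t t' * h t' * g t ∂μ) + h t * g t * w t * (∫ t', q t' ∂μ)
        - ∫ t', imhFlow w q t t' * h t * g t ∂μ := by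
    intro t
    rw [← imh_line hw0 hwm hq0 hqm hqi hhm hhb t (g t)]
    ring
  simp only [hL, hR]
  -- integrability of the pieces as functions of `t`
  have hF1 := hprod hgm hhm hgb hhb            -- s(t,t') g(t') h(t)
  have hF2 := hprod hhm hgm hhb hgb            -- s(t,t') h(t') g(t)
  have hgh : ∀ t, |g t * h t| ≤ Bg * Bh := fun t => by
    rw [abs_mul]
    exact mul_le_mul (hgb t) (hhb t) (abs_nonneg _) ((abs_nonneg _).trans (hgb t))
  have hF3 : Integrable (fun p : X × X => imhFlow w q p.1 p.2 * (1 : ℝ) * (g p.1 * h p.1))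
      (μ.prod μ) :=
    hprod measurable_const (hgm.mul hhm) (Ba := 1) (fun _ => by simp) hgh
  have hI1t : Integrable (fun t => ∫ t', imhFlow w q t t' * g t' * h t ∂μ) μ := hF1.integral_prod_left
  have hI2t : Integrable (fun t => ∫ t', imhFlow w q t t' * h t' * g t ∂μ) μ := hF2.integral_prod_left
  have hI3t : Integrable (fun t => ∫ t', imhFlow w q t t' * g t * h t ∂μ) μ := by
    refine hF3.integral_prod_left.congr (Eventually.of_forall fun t => ?_)
    refine integral_congr_ae (Eventually.of_forall fun t' => ?_)
    dsimp only
    ring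
  have hI3t' : Integrable (fun t => ∫ t', imhFlow w q t t' * h t * g t ∂μ) μ := by
    refine hI3t.congr (Eventually.of_forall fun t => ?_)
    refine integral_congr_ae (Eventually.of_forall fun t' => ?_)
    dsimp only
    ring
  have hDm : Integrable (fun t => g t * h t * w t * ∫ t', q t' ∂μ) μ := by
    have h1 : Integrable (fun t => g t * h t * w t) μ := by
      refine Integrable.mono' (hwi.const_mul (Bg * Bh)) ((hgm.mul hhm).mul hwm).aestronglyMeasurable
        (Eventually.of_forall fun t => ?_)
      rw [Real.norm_eq_abs, abs_mul, abs_of_pos (hw0 t)]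
      exact mul_le_mul_of_nonneg_right (hgh t) (hw0 t).le
    exact h1.mul_const _
  have hDm' : Integrable (fun t => h t * g t * w t * ∫ t', q t' ∂μ) μ := by
    refine hDm.congr (Eventually.of_forall fun t => ?_)
    dsimp only
    ring
  have hA1 : Integrable (fun t => (∫ t', imhFlow w q t t' * g t' * h t ∂μ)
      + g t * h t * w t * ∫ t', q t' ∂μ) μ := hI1t.add hDm
  have hA2 : Integrable (fun t => (∫ t', imhFlow w q t t' * h t' * g t ∂μ)
      + h t * g t * w t * ∫ t', q t' ∂μ) μ := hI2t.add hDm'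
  rw [integral_sub hA1 hI3t, integral_add hI1t hDm, integral_sub hA2 hI3t', integral_add hI2t hDm']
  -- the diagonal pieces agree pointwise; the off-diagonal ones by Fubini + symmetry of the flow
  have hdiag1 : ∫ t, g t * h t * w t * ∫ t', q t' ∂μ ∂μ = ∫ t, h t * g t * w t * ∫ t', q t' ∂μ ∂μ := by
    refine integral_congr_ae (Eventually.of_forall fun t => ?_)
    dsimp only
    ring
  have hdiag2 : ∫ t, ∫ t', imhFlow w q t t' * g t * h t ∂μ ∂μ
      = ∫ t, ∫ t', imhFlow w q t t' * h t * g t ∂μ ∂μ := by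
    refine integral_congr_ae (Eventually.of_forall fun t => ?_)
    refine integral_congr_ae (Eventually.of_forall fun t' => ?_)
    dsimp only
    ring
  have hswap : ∫ t, ∫ t', imhFlow w q t t' * g t' * h t ∂μ ∂μ
      = ∫ t, ∫ t', imhFlow w q t t' * h t' * g t ∂μ ∂μ := by
    rw [integral_integral_swap hF1]
    refine integral_congr_ae (Eventually.of_forall fun t' => ?_)
    refine integral_congr_ae (Eventually.of_forall fun t => ?_)
    dsimp only
    rw [imhFlow_symm w q t t']
    ring
  rw [hdiag1, hdiag2, hswap]

end General

/-! ## §2 The lattice: the flow sampler for φ⁴ satisfies detailed balance -/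

section Lattice

variable {n : ℕ}

/-- **THE FLOW SAMPLER IS REVERSIBLE FOR LATTICE φ⁴ ON `ℝ^Λ`.**  Coercive action (every `λ > 0`,
any real `J`; or a positive-definite free field), positive measurable integrable model density
`q`, bounded measurable `f`, `g`: `∫ (K f)·g·e^{−S} dφ = ∫ f·(K g)·e^{−S} dφ`. -/
theorem imh_reversible {J : Fin (n + 1) → Fin (n + 1) → ℝ} {lam ε K : ℝ} (hε : 0 < ε)
    (hS : ∀ φ : Fin (n + 1) → ℝ, ε * ∑ w, φ w ^ 2 - K ≤ latticePhi4Action J lam φ)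
    {q : (Fin (n + 1) → ℝ) → ℝ} (hq0 : ∀ φ, 0 < q φ) (hqm : Measurable q) (hqi : Integrable q)
    {f g : (Fin (n + 1) → ℝ) → ℝ} (hfm : Measurable f) (hgm : Measurable g) {Bf Bg : ℝ}
    (hfb : ∀ φ, |f φ| ≤ Bf) (hgb : ∀ φ, |g φ| ≤ Bg) :
    ∫ φ, imhOpPhi4 J lam q f φ * g φ * gibbsWeight J lam φ
      = ∫ φ, f φ * imhOpPhi4 J lam q g φ * gibbsWeight J lam φ := by
  unfold imhOpPhi4 imhAcceptPhi4
  exact imh_integral_symm (μ := (volume : Measure (Fin (n + 1) → ℝ)))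
    (fun φ => gibbsWeight_pos J lam φ) (continuous_gibbsWeight J lam).measurable
    (integrable_gibbsWeight_of_coercive hε hS) hq0 hqm hqi hfm hgm hfb hgb

/-- **Every `λ > 0`, every real coupling matrix, every positive model density**: `⟨(K f) g⟩ = ⟨f (K g)⟩`
in the φ⁴ Gibbs law — detailed balance of the flow sampler, however badly the flow is trained. -/
theorem imh_reversible_phi4 {lam : ℝ} (hlam : 0 < lam) (J : Fin (n + 1) → Fin (n + 1) → ℝ)
    {q : (Fin (n + 1) → ℝ) → ℝ} (hq0 : ∀ φ, 0 < q φ) (hqm : Measurable q) (hqi : Integrable q)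
    {f g : (Fin (n + 1) → ℝ) → ℝ} (hfm : Measurable f) (hgm : Measurable g) {Bf Bg : ℝ}
    (hfb : ∀ φ, |f φ| ≤ Bf) (hgb : ∀ φ, |g φ| ≤ Bg) :
    gibbsExpect J lam (fun φ => imhOpPhi4 J lam q f φ * g φ)
      = gibbsExpect J lam (fun φ => f φ * imhOpPhi4 J lam q g φ) := by
  unfold gibbsExpect
  rw [imh_reversible one_pos (latticePhi4Action_coercive hlam J) hq0 hqm hqi hfm hgm hfb hgb]

end Lattice

end Summit.Ventures.LatticeQCDFlow.Exactness
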